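import Mathlib
import Summits.Ventures.PercRepro2.SharpL2
import Summits.Ventures.PercRepro2.HalfTPart

/-!
# The `T`-world statement SHARP-T2: the `R`-slack is not needed (blind cell PercRepro2, night-1 g36)

`SL` splits over the two worlds as `SL = SLT + SLR` with

  `SLT = P(R) · [P(T) P(T,bL,oL) − P(T,bL) P(T,oL)]`  (`= P(R) P(T)² Cov_T(bL, oL)`, of either sign),
  `SLR = P(T) · [P(R,bL) P(R,oH) − P(R) P(R,bL,oH)]`  (`= P(T) P(R)² (−Cov_R(bL, oH)) ≥ 0`, `Rpart_nonneg`),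

and `SL2 = D P(Q) SL + oLSlack · X` (`SharpL2.lean`).  This file names the statement that drops the
`R`-slack altogether:

* **`SLT2`** `= D P(Q) · SLT + oLSlack · X` and **`SharpT2 := 0 ≤ SLT2`** — in the three-term form
  `μ(T) Cov_T(bL, oL) + μ(T) μ(R) (P(bL|R) − P(bL|T)) (P(oL|PD) − P(oL|T)) ≥ 0`: the negative
  correlation of `bL` and `oL` in the world `a₃ ∈ H` is covered by the product of the two drops alone;
* **`SL2_eq`**: `SL2 = SLT2 + D P(Q) · SLR`; **`SharpL2_of_SharpT2`**: SHARP-T2 ⟹ SHARP-L2, hence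
  **`HalfL_of_SharpT2`** and the closure chain **`HalfL_all_of_SharpT2_all`**, **`HCov_all_of_SharpT2_all`**.

Census (night-1 g36, own code, kit adversary with exact re-check): SHARP-T2 survives 23,040 + 6,912
(+ K₆) weight climbs (n = 5–8, the non-reducible class; j336175, j336176, j336177) with 0 float
negatives at all, while its sibling with `P(bL|PD) − P(bL|T)` in place of `P(bL|R) − P(bL|T)` is
refuted (exact negatives in j336175) — the `R`-based drop of `b` and the `PD`-based drop of `o` are
the right pair.  SHARP-T2 is the strongest statement of the centring family standing.
-/

namespace Summit.Ventures.PercRepro2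

namespace SharpHalves

open CovForm

section Defs

variable {V : Type*} {E : Type*} [Fintype E] [DecidableEq E] [DecidableEq V] {R : Type*}
  [Field R] [LinearOrder R]

/-- **The `T`-part of `SL`**: `SLT = P(R) [P(T) P(T,bL,oL) − P(T,bL) P(T,oL)]`. -/
noncomputable def SLT (p : E → R) (ends : E → Sym2 V) (o a₁ a₂ a₃ b : V) : R :=
  prob p (avoidAll ends a₂ {a₁, a₃}) *
    (prob p (TEvent ends a₁ a₂ a₃) *
        prob p (TEvent ends a₁ a₂ a₃ ∩ (connEvent ends a₁ o ∩ connEvent ends a₁ b)) -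
      prob p (TEvent ends a₁ a₂ a₃ ∩ connEvent ends a₁ b) *
        prob p (TEvent ends a₁ a₂ a₃ ∩ connEvent ends a₁ o))

/-- **The `R`-part of `SL`**: `SLR = P(T) [P(R,bL) P(R,oH) − P(R,bL,oH) P(R)]` (`≥ 0`, `Rpart_nonneg`). -/
noncomputable def SLR (p : E → R) (ends : E → Sym2 V) (o a₁ a₂ a₃ b : V) : R :=
  prob p (TEvent ends a₁ a₂ a₃) *
    (prob p (avoidAll ends a₂ {a₁, a₃} ∩ connEvent ends a₁ b) *
        prob p (avoidAll ends a₂ {a₁, a₃} ∩ connEvent ends a₂ o) -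
      prob p (avoidAll ends a₂ {a₁, a₃} ∩ (connEvent ends a₂ o ∩ connEvent ends a₁ b)) *
        prob p (avoidAll ends a₂ {a₁, a₃}))

/-- **`SLT2`** `= D P(Q) · SLT + oLSlack · X`: the `T`-world form at the centring `c₂`, without the
`R`-slack. -/
noncomputable def SLT2 (p : E → R) (ends : E → Sym2 V) (o a₁ a₂ a₃ b : V) : R :=
  prob p (PDEvent ends a₁ a₂ a₃) * prob p (avoidAll ends a₂ {a₁}) * SLT p ends o a₁ a₂ a₃ b +
    oLSlack p ends o a₁ a₂ a₃ * bLSlack p ends a₁ a₂ a₃ b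

/-- **SHARP-T2**: `0 ≤ SLT2`. -/
def SharpT2 (p : E → R) (ends : E → Sym2 V) (o a₁ a₂ a₃ b : V) : Prop :=
  0 ≤ SLT2 p ends o a₁ a₂ a₃ b

omit [LinearOrder R] in
/-- `SL = SLT + SLR`. -/
lemma SL_eq_SLT_add_SLR (p : E → R) (ends : E → Sym2 V) (o a₁ a₂ a₃ b : V) :
    SL p ends o a₁ a₂ a₃ b = SLT p ends o a₁ a₂ a₃ b + SLR p ends o a₁ a₂ a₃ b := by
  unfold SL SLT SLR
  ring

omit [LinearOrder R] in
/-- `SL2 = SLT2 + D P(Q) · SLR`. -/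
lemma SL2_eq (p : E → R) (ends : E → Sym2 V) (o a₁ a₂ a₃ b : V) :
    SL2 p ends o a₁ a₂ a₃ b =
      SLT2 p ends o a₁ a₂ a₃ b +
        prob p (PDEvent ends a₁ a₂ a₃) * prob p (avoidAll ends a₂ {a₁}) * SLR p ends o a₁ a₂ a₃ b := by
  unfold SL2 SLT2
  rw [SL_eq_SLT_add_SLR]
  ring

end Defs

section Closure

variable (R : Type*) [Field R] [LinearOrder R] [IsStrictOrderedRing R]

/-- **SHARP-T2 for every finite graph and every labelling.** -/
def SharpT2_all : Prop :=
  ∀ (V E : Type) [Fintype V] [DecidableEq V] [Fintype E] [DecidableEq E]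
    (ends : E → Sym2 V) (p : E → R), IsProbVec p →
    ∀ o a₁ a₂ a₃ b : V, a₁ ≠ a₂ → a₁ ≠ a₃ → a₂ ≠ a₃ → o ≠ a₁ → o ≠ a₂ → o ≠ a₃ → o ≠ b →
      b ≠ a₁ → b ≠ a₂ → b ≠ a₃ → SharpT2 p ends o a₁ a₂ a₃ b

end Closure

section Reduction

variable {V : Type*} {E : Type*} [Fintype E] [DecidableEq E] [Fintype V] [DecidableEq V]
  {R : Type*} [Field R] [LinearOrder R] [IsStrictOrderedRing R]

/-- `0 ≤ SLR` (`Rpart_nonneg`, the avoidance-conditioned BHK cross-cluster slack on `R`). -/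
lemma SLR_nonneg (p : E → R) (hp : IsProbVec p) (ends : E → Sym2 V) (o a₁ a₂ a₃ b : V) :
    0 ≤ SLR p ends o a₁ a₂ a₃ b := by
  unfold SLR
  exact mul_nonneg (prob_nonneg hp _) (sub_nonneg.mpr (Rpart_nonneg p ends o a₁ a₂ a₃ b hp))

/-- **SHARP-T2 ⟹ SHARP-L2.** -/
theorem SharpL2_of_SharpT2 (p : E → R) (hp : IsProbVec p) (ends : E → Sym2 V) (o a₁ a₂ a₃ b : V)
    (h : SharpT2 p ends o a₁ a₂ a₃ b) : SharpL2 p ends o a₁ a₂ a₃ b := by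
  unfold SharpL2
  rw [SL2_eq]
  unfold SharpT2 at h
  exact add_nonneg h (mul_nonneg (mul_nonneg (prob_nonneg hp _) (prob_nonneg hp _))
    (SLR_nonneg p hp ends o a₁ a₂ a₃ b))

/-- **HALF-L ⟸ SHARP-T2** on every instance. -/
theorem HalfL_of_SharpT2 (p : E → R) (hp : IsProbVec p) (ends : E → Sym2 V) (o a₁ a₂ a₃ b : V)
    (h : SharpT2 p ends o a₁ a₂ a₃ b) : HalfL p ends o a₁ a₂ a₃ b :=
  HalfL_of_SharpL2 p hp ends o a₁ a₂ a₃ b (SharpL2_of_SharpT2 p hp ends o a₁ a₂ a₃ b h)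

end Reduction

section ClosureChain

variable (R : Type*) [Field R] [LinearOrder R] [IsStrictOrderedRing R]

/-- **`SharpL2_all ⟸ SharpT2_all`.** -/
theorem SharpL2_all_of_SharpT2_all (h : SharpT2_all R) : SharpL2_all R := by
  intro V E _ _ _ _ ends p hp o a₁ a₂ a₃ b h12 h13 h23 ho1 ho2 ho3 hob hb1 hb2 hb3
  exact SharpL2_of_SharpT2 p hp ends o a₁ a₂ a₃ b
    (h V E ends p hp o a₁ a₂ a₃ b h12 h13 h23 ho1 ho2 ho3 hob hb1 hb2 hb3)

/-- **`HalfL_all ⟸ SharpT2_all`.** -/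
theorem HalfL_all_of_SharpT2_all (h : SharpT2_all R) : HalfL_all R :=
  HalfL_all_of_SharpL2_all R (SharpL2_all_of_SharpT2_all R h)

/-- **`HCov_all ⟸ SharpT2_all`**: (HCOV) for every finite graph from the `T`-world statement. -/
theorem HCov_all_of_SharpT2_all (h : SharpT2_all R) : HCov_all R :=
  HCov_all_of_HalfL_all R (HalfL_all_of_SharpT2_all R h)

end ClosureChain

end SharpHalves

end Summit.Ventures.PercRepro2
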